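import Literature.NumberTheory.CubicFields.CubicFieldDiscriminant307ClassNumber
import Mathlib.NumberTheory.NumberField.ClassNumber
import Mathlib.NumberTheory.NumberField.Discriminant.Basic
import Mathlib.Analysis.Real.Pi.Bounds
import Mathlib.Tactic.ComputeDegree
import Mathlib.Tactic.NormNum.Prime
import HarnessLib

/-!
# The cubic field of discriminant `−139`: `F = ℚ(θ)`, `θ³ − 4θ² + 6θ − 1 = 0` — `𝓞_F = ℤ[θ]`, `d_F = −139`,
# signature `(1, 1)`, the primes above `2` and `3`, and CLASS NUMBER ONE (LMFDB number field 3.1.139.1) — PROVED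

Topic `Literature/NumberTheory/CubicFields`, namespace `Literature.NumberTheory.CubicFields.CubicDisc139` (the object: the
cubic field of discriminant `−139`; sister of `CubicFieldDiscriminant307ClassNumber.lean` (same seat, same template) and companion of
`CubicFieldDiscriminantTwentyThree*.lean` / `…ThirtyOne*.lean`).  THEOREMS ONLY (no definition, no named fact, no instance, no notation);
every statement is PROVED.  Written by the prover seat `bsd-line-att-p4` g27 (cell `bsd-f1-sign2`) to discharge, in the kernel, the one
displayed datum `2 ∤ h(ℚ(β))` of the `139a1` row of crux C2 of route `AlignedTransportAtTwo` (`ℚ(β)`, `4β³ + 5β² − 12β − 16 = 0`, IS this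
field: `θ = 9 + ¼β − 3β²` is att-p5 g31's unit `η = (144 + 4β − 3(4β)²)/16`).  The generator chosen here is the UNIT `θ = η` (norm `+1`);
`X³ − 4X² + 6X − 1` and LMFDB's `x³ − x² + x + 2` define the same field (both have discriminant `−139`, which is a field discriminant exactly once).

## Source

[LMFDB] The L-functions and Modular Forms Database, number field `3.1.139.1`: defining polynomial `x³ − x² + x + 2`,
degree `3`, signature `[1, 1]`, discriminant `−139`, monogenic, **class number `1`** (table entries).
D. A. Marcus, *Number Fields*, 2nd ed. (2018) [Marcus2018], Ch. 2 Ex. 27 (index criterion), Ch. 3 Thm. 27 (Dedekind–Kummer),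
Ch. 5 Thm. 37 and Cor. 2 (the class group is generated by the primes of norm at most the Minkowski bound).

## Carrier

`F` is ANY number field with `[F : ℚ] = 3` containing `α` with `α³ − 4α² + 6α − 1 = 0`, i.e. `aeval α f = 0` for the tree's
`f = MonicCubic.poly (-4) 6 (-1) = X³ − 4X² + 6X − 1 ∈ ℤ[X]` (every model of the cubic field of discriminant `−139`; uniqueness of
that field — `h(ℚ(√−139)) = 3` — is not used).  `θ := MonicCubic.thetaInt hα ∈ 𝓞 F` (a unit: `θ(θ² − 4θ + 6) = 1`).

## What is formalised (all PROVED)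

* §1 the polynomial: `disc_eq` (`Δ(f) = −139`), `isUnit_of_disc_eq_sq_mul` (`139` is prime, so the square-factor condition of the
  tree's index criterion holds), `no_root_five` / `irreducible_polyQ` (`f` has no root mod `5`, hence is irreducible over `ℚ`),
  `polyMod_two` (`f ≡ (X + 1)(X² + X + 1) (mod 2)`), `polyMod_three` (`f ≡ (X + 1)(X² + X + 2) (mod 3)`); the irreducibility of the two
  quadratic factors is REUSED from the sister file (`CubicDisc307.irreducible_quad_two/three`, same factors).
* §2 the field: `discr_eq` (**`d_F = −139`**), `adjoin_thetaInt_eq_top` (**`𝓞_F = ℤ[θ]`**), `nrComplexPlaces_eq_one` /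
  `nrRealPlaces_eq_one` (**signature `(1, 1)`**).
* §3 the four small primes are principal, by EXPLICIT GENERATORS (pure ideal arithmetic from `θ³ = 4θ² − 6θ + 1`):
  `(2, θ + 1) = (θ − 1)` (`N(θ − 1) = −2`), `(2, θ² + θ + 1) = (θ² − 3θ + 3)` (`(θ − 1)(θ² − 3θ + 3) = −2`), `(3, θ + 1) = (θ − 2)`
  (`N(θ − 2) = −3`), `(3, θ² + θ + 2) = (θ² − 2θ + 2)` (`(θ − 2)(θ² − 2θ + 2) = −3`); hence **every prime of `𝓞_F` above `2` or `3` is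
  principal** (`isPrincipal_of_mem_primesOver_two` / `_three`, Dedekind–Kummer through the tree's `MonicCubic.exists_factor_of_mem_primesOver`).
* §4 ★ **`h_F = 1`** (`isPrincipalIdealRing`, `classNumber_eq_one`): Minkowski's bound is `(4/π)(3!/3³)√139 < 4`, so by Mathlib's
  `RingOfIntegers.isPrincipalIdealRing_of_isPrincipal_of_pow_le_of_mem_primesOver_of_mem_Icc` it suffices that the primes above
  `2` and `3` be principal (§3).  Corollary `not_two_dvd_classNumber` (the form consumed downstream).

## Mathlib / tree search
Tree (consumed BY NAME): `MonicCubic.{poly, polyQ, polyMod, disc, thetaInt, thetaInt_rel, discr_eq_disc, adjoin_thetaInt_eq_top,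
exists_factor_of_mem_primesOver, irreducible_polyQ_of_no_root}` (`NumberFields/CubicField{Explicit,Integers,DedekindKummer}`); pattern of
`CubicFields.CubicDisc307` (this seat, verbatim template), `CubicDisc23` (signature) and `NumberFields.CyclicCubic1339A` (generators).  Mathlib:
`RingOfIntegers.isPrincipalIdealRing_of_isPrincipal_of_pow_le_of_mem_primesOver_of_mem_Icc`, `NumberField.classNumber_eq_one_iff`,
`NumberField.sign_discr`, `Real.pi_gt_d2`, `Real.sqrt_lt'`, `Nat.floor_lt'`, `Polynomial.irreducible_of_degree_le_three_of_not_isRoot`.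
`rg "139" lean/Literature/NumberTheory/{CubicFields,NumberFields}` → only counting files: the invariants of this field are new in the tree.

## References
* [LMFDB] The LMFDB Collaboration, The L-functions and Modular Forms Database, number field 3.1.139.1.
* [Marcus2018] D. A. Marcus, *Number Fields*, 2nd ed., Universitext, Springer 2018, Ch. 2 Ex. 27, Ch. 3 Thm. 27, Ch. 5 Thm. 37.
-/

noncomputable section

open Polynomial NumberField NumberField.InfinitePlace Ideal Module Real
open Literature.NumberTheory.NumberFields
open Literature.NumberTheory.NumberFields.MonicCubic

namespace Literature.NumberTheory.CubicFields.CubicDisc139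

/-! ## §1 The polynomial `f = X³ − 4X² + 6X − 1` -/

/-- `Δ(X³ − 4X² + 6X − 1) = −139` (`a = −4, b = 6, c = −1`: `a²b² − 4b³ − 4a³c − 27c² + 18abc = 576 − 864 − 256 − 27 + 432`).
[cite: LMFDB, number field 3.1.139.1 (discriminant −139)] -/
theorem disc_eq : disc (-4) 6 (-1) = -139 := by
  norm_num [disc]

/-- The square-factor condition of the tree's index criterion for `f`: `−139 = r²e` with `|e| > 2` forces `r = ±1`
(`139` is prime). [cite: Marcus2018, Ch. 2, Exercise 27] -/
theorem isUnit_of_disc_eq_sq_mul : ∀ r e : ℤ, disc (-4) 6 (-1) = r ^ 2 * e → 2 < |e| → IsUnit r := by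
  intro r e h _
  rw [disc_eq] at h
  have hdvd : r.natAbs ^ 2 ∣ 139 := by
    have h1 : r ^ 2 ∣ (139 : ℤ) := ⟨-e, by linear_combination -h⟩
    have h2 : ((r.natAbs ^ 2 : ℕ) : ℤ) ∣ (139 : ℕ) := by
      rw [Nat.cast_pow, Int.natCast_natAbs, sq_abs]; exact_mod_cast h1
    exact Int.natCast_dvd_natCast.mp h2
  rcases (Nat.dvd_prime (by norm_num : Nat.Prime 139)).mp hdvd with h1 | h139
  · rw [Int.isUnit_iff_natAbs_eq]
    exact (Nat.pow_eq_one.mp h1).resolve_right two_ne_zero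
  · exfalso
    have hle : r.natAbs ≤ 12 := by nlinarith
    interval_cases hr : r.natAbs <;> omega

/-- `f` has no root modulo `5` (`f(0..4) ≡ 4, 2, 3, 3, 3`). [cite: Marcus2018, Ch. 3, Thm. 27] -/
theorem no_root_five :
    ∀ r : ZMod 5, r ^ 3 + ((-4 : ℤ) : ZMod 5) * r ^ 2 + ((6 : ℤ) : ZMod 5) * r + ((-1 : ℤ) : ZMod 5) ≠ 0 := by
  decide

/-- **`f = X³ − 4X² + 6X − 1` is irreducible over `ℚ`** (no root modulo `5`; the tree's `irreducible_polyQ_of_no_root`).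
[cite: LMFDB, number field 3.1.139.1 (degree 3)] -/
theorem irreducible_polyQ : Irreducible (polyQ (-4) 6 (-1)) :=
  haveI : Fact (Nat.Prime 5) := ⟨by norm_num⟩
  irreducible_polyQ_of_no_root 5 no_root_five

/-- `f mod p` written out: `f̄ = X³ − 4X² + 6X − 1 ∈ 𝔽_p[X]`. [cite: Marcus2018, Ch. 3, Thm. 27] -/
theorem polyMod_eq (p : ℕ) : polyMod (-4) 6 (-1) p = X ^ 3 - 4 * X ^ 2 + 6 * X - 1 := by
  simp [polyMod, poly]; ring

/-- `f ≡ (X + 1)·(X² + X + 1) (mod 2)`. [cite: Marcus2018, Ch. 3, Thm. 27] -/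
theorem polyMod_two : polyMod (-4) 6 (-1) 2 = (X + 1) * (X ^ 2 + X + 1) := by
  rw [polyMod_eq]
  have h2 : (2 : (ZMod 2)[X]) = 0 := by
    rw [show (2 : (ZMod 2)[X]) = C 2 from (map_natCast C 2).symm, show (2 : ZMod 2) = 0 from rfl, C_0]
  linear_combination (-3 * X ^ 2 + 2 * X - 1) * h2

/-- `f ≡ (X + 1)·(X² + X + 2) (mod 3)`. [cite: Marcus2018, Ch. 3, Thm. 27] -/
theorem polyMod_three : polyMod (-4) 6 (-1) 3 = (X + 1) * (X ^ 2 + X + 2) := by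
  rw [polyMod_eq]
  have h3 : (3 : (ZMod 3)[X]) = 0 := by
    rw [show (3 : (ZMod 3)[X]) = C 3 from (map_natCast C 3).symm, show (3 : ZMod 3) = 0 from rfl, C_0]
  linear_combination (-2 * X ^ 2 + X - 1) * h3

/-! ## §2 The field `F`: `d_F = −139`, `𝓞_F = ℤ[θ]`, signature `(1, 1)` -/

section NumberField

variable {F : Type*} [Field F] [NumberField F] {α : F}

/-- **`d_F = −139`** for a cubic number field `F ∋ α` with `α³ − 4α² + 6α − 1 = 0` (index criterion: `Δ(f) = −139` is
squarefree, so `1, α, α²` is an integral basis). [cite: LMFDB, number field 3.1.139.1 (discriminant −139)]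
[cite: Marcus2018, Ch. 2, Exercise 27] -/
theorem discr_eq (h3 : finrank ℚ F = 3) (hα : aeval α (poly (-4) 6 (-1)) = 0) : discr F = -139 := by
  rw [discr_eq_disc irreducible_polyQ hα h3 isUnit_of_disc_eq_sq_mul, disc_eq]

/-- **`𝓞_F = ℤ[θ]`** (inside `𝓞_F`). [cite: LMFDB, number field 3.1.139.1 (monogenic)] [cite: Marcus2018, Ch. 2, Exercise 27] -/
theorem adjoin_thetaInt_eq_top (h3 : finrank ℚ F = 3) (hα : aeval α (poly (-4) 6 (-1)) = 0) :
    Algebra.adjoin ℤ ({thetaInt hα} : Set (𝓞 F)) = ⊤ :=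
  MonicCubic.adjoin_thetaInt_eq_top irreducible_polyQ hα h3 isUnit_of_disc_eq_sq_mul

/-- **`F` has exactly one complex place** (`r₂ = 1`): `d_F = −139 < 0` has sign `(−1)^{r₂}`, and `r₁ + 2r₂ = 3`.
[cite: LMFDB, number field 3.1.139.1 (signature [1,1])] -/
theorem nrComplexPlaces_eq_one (h3 : finrank ℚ F = 3) (hα : aeval α (poly (-4) 6 (-1)) = 0) : nrComplexPlaces F = 1 := by
  have hsum := card_add_two_mul_card_eq_rank F
  rw [h3] at hsum
  have hsign := NumberField.sign_discr F
  rw [discr_eq h3 hα] at hsign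
  have hle : nrComplexPlaces F ≤ 1 := by omega
  rcases Nat.le_one_iff_eq_zero_or_eq_one.mp hle with h0 | h1
  · rw [h0, pow_zero, show (-139 : ℤ).sign = -1 from rfl] at hsign
    norm_num at hsign
  · exact h1

/-- **`F` has exactly one real place** (`r₁ = 1`). [cite: LMFDB, number field 3.1.139.1 (signature [1,1])] -/
theorem nrRealPlaces_eq_one (h3 : finrank ℚ F = 3) (hα : aeval α (poly (-4) 6 (-1)) = 0) : nrRealPlaces F = 1 := by
  have hsum := card_add_two_mul_card_eq_rank F
  rw [h3, nrComplexPlaces_eq_one h3 hα] at hsum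
  omega

/-! ## §3 The primes above `2` and `3` are principal -/

/-- `(θ − 1)·(θ² − 3θ + 3) = −2` in `𝓞_F` (`f = (X − 1)(X² − 3X + 3) + 2`). [cite: LMFDB, number field 3.1.139.1 (class number 1)] -/
theorem theta_sub_one_mul_eq (hα : aeval α (poly (-4) 6 (-1)) = 0) :
    (thetaInt hα - 1) * (thetaInt hα ^ 2 - 3 * thetaInt hα + 3) = -2 := by
  have h := thetaInt_rel hα
  push_cast at h
  linear_combination h

/-- `(θ − 2)·(θ² − 2θ + 2) = −3` in `𝓞_F` (`f = (X − 2)(X² − 2X + 2) + 3`). [cite: LMFDB, number field 3.1.139.1 (class number 1)] -/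
theorem theta_sub_two_mul_eq (hα : aeval α (poly (-4) 6 (-1)) = 0) :
    (thetaInt hα - 2) * (thetaInt hα ^ 2 - 2 * thetaInt hα + 2) = -3 := by
  have h := thetaInt_rel hα
  push_cast at h
  linear_combination h

/-- **`(2, θ + 1) = (θ − 1)`**: the residue-degree-one prime above `2` is generated by `θ − 1` (`N(θ − 1) = −2`;
`2 = −(θ − 1)(θ² − 3θ + 3)`). [cite: Marcus2018, Ch. 3, Thm. 27] -/
theorem span_two_lin_eq (hα : aeval α (poly (-4) 6 (-1)) = 0) :
    span {(2 : 𝓞 F), thetaInt hα + 1} = span {thetaInt hα - 1} := by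
  apply le_antisymm
  · rw [span_le]
    rintro x hx
    rcases hx with rfl | hx
    · exact mem_span_singleton'.mpr ⟨-(thetaInt hα ^ 2 - 3 * thetaInt hα + 3), by linear_combination -(theta_sub_one_mul_eq hα)⟩
    · rw [Set.mem_singleton_iff.mp hx]
      exact mem_span_singleton'.mpr ⟨-thetaInt hα ^ 2 + 3 * thetaInt hα - 2, by linear_combination -(theta_sub_one_mul_eq hα)⟩
  · rw [span_singleton_le_iff_mem, mem_span_pair]
    exact ⟨-1, 1, by ring⟩

/-- **`(2, θ² + θ + 1) = (θ² − 3θ + 3)`**: the residue-degree-two prime above `2` is generated by `θ² − 3θ + 3 = −2/(θ − 1)` (norm `4`).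
[cite: Marcus2018, Ch. 3, Thm. 27] -/
theorem span_two_quad_eq (hα : aeval α (poly (-4) 6 (-1)) = 0) :
    span {(2 : 𝓞 F), thetaInt hα ^ 2 + thetaInt hα + 1} = span {thetaInt hα ^ 2 - 3 * thetaInt hα + 3} := by
  apply le_antisymm
  · rw [span_le]
    rintro x hx
    rcases hx with rfl | hx
    · exact mem_span_singleton'.mpr ⟨-(thetaInt hα - 1), by linear_combination -(theta_sub_one_mul_eq hα)⟩
    · rw [Set.mem_singleton_iff.mp hx]
      exact mem_span_singleton'.mpr ⟨-2 * thetaInt hα ^ 2 + 3 * thetaInt hα,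
        by linear_combination (1 - 2 * thetaInt hα) * theta_sub_one_mul_eq hα⟩
  · rw [span_singleton_le_iff_mem, mem_span_pair]
    exact ⟨1 - 2 * thetaInt hα, 1, by ring⟩

/-- **`(3, θ + 1) = (θ − 2)`**: the residue-degree-one prime above `3` is generated by `θ − 2` (`N(θ − 2) = −3`;
`3 = −(θ − 2)(θ² − 2θ + 2)`). [cite: Marcus2018, Ch. 3, Thm. 27] -/
theorem span_three_lin_eq (hα : aeval α (poly (-4) 6 (-1)) = 0) :
    span {(3 : 𝓞 F), thetaInt hα + 1} = span {thetaInt hα - 2} := by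
  apply le_antisymm
  · rw [span_le]
    rintro x hx
    rcases hx with rfl | hx
    · exact mem_span_singleton'.mpr ⟨-(thetaInt hα ^ 2 - 2 * thetaInt hα + 2), by linear_combination -(theta_sub_two_mul_eq hα)⟩
    · rw [Set.mem_singleton_iff.mp hx]
      exact mem_span_singleton'.mpr ⟨-thetaInt hα ^ 2 + 2 * thetaInt hα - 1, by linear_combination -(theta_sub_two_mul_eq hα)⟩
  · rw [span_singleton_le_iff_mem, mem_span_pair]
    exact ⟨-1, 1, by ring⟩

/-- **`(3, θ² + θ + 2) = (θ² − 2θ + 2)`**: the residue-degree-two prime above `3` is generated by `θ² − 2θ + 2 = −3/(θ − 2)`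
(norm `9`). [cite: Marcus2018, Ch. 3, Thm. 27] -/
theorem span_three_quad_eq (hα : aeval α (poly (-4) 6 (-1)) = 0) :
    span {(3 : 𝓞 F), thetaInt hα ^ 2 + thetaInt hα + 2} = span {thetaInt hα ^ 2 - 2 * thetaInt hα + 2} := by
  apply le_antisymm
  · rw [span_le]
    rintro x hx
    rcases hx with rfl | hx
    · exact mem_span_singleton'.mpr ⟨-(thetaInt hα - 2), by linear_combination -(theta_sub_two_mul_eq hα)⟩
    · rw [Set.mem_singleton_iff.mp hx]
      exact mem_span_singleton'.mpr ⟨-thetaInt hα ^ 2 + 2 * thetaInt hα + 1,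
        by linear_combination (-thetaInt hα) * theta_sub_two_mul_eq hα⟩
  · rw [span_singleton_le_iff_mem, mem_span_pair]
    exact ⟨-thetaInt hα, 1, by ring⟩

/-- **Every prime of `𝓞_F` above `2` is principal**: by Dedekind–Kummer (`𝓞_F = ℤ[θ]`, `f ≡ (X + 1)(X² + X + 1) (mod 2)`) such a prime
is `(2, θ + 1)` or `(2, θ² + θ + 1)`, i.e. `(θ − 1)` or `(θ² − 3θ + 3)`. [cite: Marcus2018, Ch. 3, Thm. 27] [cite: LMFDB, number field 3.1.139.1 (class number 1)] -/
theorem isPrincipal_of_mem_primesOver_two (h3 : finrank ℚ F = 3) (hα : aeval α (poly (-4) 6 (-1)) = 0) {P : Ideal (𝓞 F)}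
    (hP : P ∈ primesOver (span {((2 : ℕ) : ℤ)}) (𝓞 F)) : Submodule.IsPrincipal P := by
  obtain ⟨Qb, hirr, hmon, hdvd, -, hspan⟩ :=
    exists_factor_of_mem_primesOver irreducible_polyQ hα h3 isUnit_of_disc_eq_sq_mul Nat.prime_two hP
  rw [polyMod_two] at hdvd
  rcases hirr.prime.dvd_or_dvd hdvd with h | h
  · have hirr1 : Irreducible (X + 1 : (ZMod 2)[X]) := by
      rw [show (X + 1 : (ZMod 2)[X]) = X - C (-1) by rw [map_neg, map_one, sub_neg_eq_add]]
      exact irreducible_X_sub_C _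
    have hQb : Qb = X + 1 := eq_of_monic_of_associated hmon (by monicity!) (hirr.associated_of_dvd hirr1 h)
    have hPeq := hspan (X + 1) (by rw [hQb]; simp)
    rw [show aeval (thetaInt hα) (X + 1 : ℤ[X]) = thetaInt hα + 1 by simp, Nat.cast_ofNat, span_two_lin_eq hα] at hPeq
    exact ⟨⟨thetaInt hα - 1, by rw [hPeq, Ideal.submodule_span_eq]⟩⟩
  · have hQb : Qb = X ^ 2 + X + 1 :=
      eq_of_monic_of_associated hmon (by monicity!) (hirr.associated_of_dvd CubicDisc307.irreducible_quad_two h)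
    have hPeq := hspan (X ^ 2 + X + 1) (by rw [hQb]; simp)
    rw [show aeval (thetaInt hα) (X ^ 2 + X + 1 : ℤ[X]) = thetaInt hα ^ 2 + thetaInt hα + 1 by simp, Nat.cast_ofNat,
      span_two_quad_eq hα] at hPeq
    exact ⟨⟨thetaInt hα ^ 2 - 3 * thetaInt hα + 3, by rw [hPeq, Ideal.submodule_span_eq]⟩⟩

/-- **Every prime of `𝓞_F` above `3` is principal**: by Dedekind–Kummer (`f ≡ (X + 1)(X² + X + 2) (mod 3)`) such a prime is
`(3, θ + 1) = (θ − 2)` or `(3, θ² + θ + 2) = (θ² − 2θ + 2)`. [cite: Marcus2018, Ch. 3, Thm. 27] [cite: LMFDB, number field 3.1.139.1 (class number 1)] -/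
theorem isPrincipal_of_mem_primesOver_three (h3 : finrank ℚ F = 3) (hα : aeval α (poly (-4) 6 (-1)) = 0) {P : Ideal (𝓞 F)}
    (hP : P ∈ primesOver (span {((3 : ℕ) : ℤ)}) (𝓞 F)) : Submodule.IsPrincipal P := by
  obtain ⟨Qb, hirr, hmon, hdvd, -, hspan⟩ :=
    exists_factor_of_mem_primesOver irreducible_polyQ hα h3 isUnit_of_disc_eq_sq_mul Nat.prime_three hP
  rw [polyMod_three] at hdvd
  rcases hirr.prime.dvd_or_dvd hdvd with h | h
  · have hirr1 : Irreducible (X + 1 : (ZMod 3)[X]) := by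
      rw [show (X + 1 : (ZMod 3)[X]) = X - C (-1) by rw [map_neg, map_one, sub_neg_eq_add]]
      exact irreducible_X_sub_C _
    have hQb : Qb = X + 1 := eq_of_monic_of_associated hmon (by monicity!) (hirr.associated_of_dvd hirr1 h)
    have hPeq := hspan (X + 1) (by rw [hQb]; simp)
    rw [show aeval (thetaInt hα) (X + 1 : ℤ[X]) = thetaInt hα + 1 by simp, Nat.cast_ofNat, span_three_lin_eq hα] at hPeq
    exact ⟨⟨thetaInt hα - 2, by rw [hPeq, Ideal.submodule_span_eq]⟩⟩
  · have hQb : Qb = X ^ 2 + X + 2 :=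
      eq_of_monic_of_associated hmon (by monicity!) (hirr.associated_of_dvd CubicDisc307.irreducible_quad_three h)
    have hPeq := hspan (X ^ 2 + X + C 2) (by rw [hQb]; simp [map_ofNat])
    rw [show aeval (thetaInt hα) (X ^ 2 + X + C 2 : ℤ[X]) = thetaInt hα ^ 2 + thetaInt hα + 2 by
        simp only [map_add, map_pow, aeval_X, aeval_C, algebraMap_int_eq, Int.coe_castRingHom, Int.cast_ofNat],
      Nat.cast_ofNat, span_three_quad_eq hα] at hPeq
    exact ⟨⟨thetaInt hα ^ 2 - 2 * thetaInt hα + 2, by rw [hPeq, Ideal.submodule_span_eq]⟩⟩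

/-! ## §4 Class number one -/

/-- **`𝓞_F` is a principal ideal domain.**  Minkowski: every ideal class contains an ideal of norm
`≤ (4/π)^{r₂} (n!/nⁿ) √|d_F| = (4/π)(6/27)√139 < 4`, and the primes of norm `≤ 3` (above `2` and `3`) are principal (§3);
Mathlib's `RingOfIntegers.isPrincipalIdealRing_of_isPrincipal_of_pow_le_of_mem_primesOver_of_mem_Icc`.
[cite: LMFDB, number field 3.1.139.1 (class number 1)] [cite: Marcus2018, Ch. 5, Thm. 37 and Cor. 2] -/
theorem isPrincipalIdealRing (h3 : finrank ℚ F = 3) (hα : aeval α (poly (-4) 6 (-1)) = 0) : IsPrincipalIdealRing (𝓞 F) := by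
  apply RingOfIntegers.isPrincipalIdealRing_of_isPrincipal_of_pow_le_of_mem_primesOver_of_mem_Icc
  rw [nrComplexPlaces_eq_one h3 hα, h3, discr_eq h3 hα]
  intro p hp hpr P hP _
  obtain ⟨hp1, hpM⟩ := Finset.mem_Icc.mp hp
  have hp3 : p ≤ 3 := by
    refine Nat.lt_succ_iff.mp (lt_of_le_of_lt hpM ((Nat.floor_lt' (by norm_num)).mpr ?_))
    have hπ := Real.pi_gt_d2
    have hπ0 := Real.pi_pos
    have hs : √(139 : ℝ) < 11.8 := by
      rw [Real.sqrt_lt' (by norm_num)]; norm_num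
    have hs0 : 0 ≤ √(139 : ℝ) := Real.sqrt_nonneg _
    have habs : |((-139 : ℤ) : ℝ)| = 139 := by norm_num
    rw [habs]
    norm_num [Nat.factorial]
    rw [div_mul_eq_mul_div, div_lt_iff₀ hπ0]
    nlinarith
  interval_cases p
  · exact absurd hpr Nat.not_prime_one
  · exact isPrincipal_of_mem_primesOver_two h3 hα hP
  · exact isPrincipal_of_mem_primesOver_three h3 hα hP

/-- ★ **`h_F = 1`: the cubic field of discriminant `−139` has class number one.** [cite: LMFDB, number field 3.1.139.1 (class number 1)] -/
theorem classNumber_eq_one (h3 : finrank ℚ F = 3) (hα : aeval α (poly (-4) 6 (-1)) = 0) : classNumber F = 1 :=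
  (classNumber_eq_one_iff (K := F)).mpr (isPrincipalIdealRing h3 hα)

/-- **`h_F` is odd** (the form consumed by the `2`-adic doors of cell `bsd-f1-sign2`). [cite: LMFDB, number field 3.1.139.1 (class number 1)] -/
theorem not_two_dvd_classNumber (h3 : finrank ℚ F = 3) (hα : aeval α (poly (-4) 6 (-1)) = 0) : ¬ 2 ∣ classNumber F := by
  rw [classNumber_eq_one h3 hα]; decide

end NumberField

end Literature.NumberTheory.CubicFields.CubicDisc139

end
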